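import Literature.RepresentationTheory.KonnoKonno2007.JunctionVacuumOverlap
import Literature.RepresentationTheory.KonnoKonno2007.JunctionLinearWeilDatum
import HarnessLib

/-!
# The vacuum-overlap phase identity `(★★)_{-1}` on the `dim W_k = 1` slots, and the unconditional linearised Weil datum

Literature reproduction (kernel, `[folklore]`; conventions of Folland 1989 §1.7, §4.2 Prop. (4.39)).  The DISCHARGE of
the hypothesis `hVV : VacuumOverlapPhase R S p₀ q₀ m` of `JunctionLinearWeilDatum` (`isArchWeilDatum_linWeil`) for
`|R| = 1`, `S = ∅`, `|Q| = 1` — the archimedean slots `U(P,Q) × U(1)` with `|Q| = 1` (`dim W_k = 1`) — with the exponent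
`m = -1`, from the closed form of the three-letter vacuum overlap proved in `JunctionVacuumOverlap`
(`vacCoeffS_hypOp_comp_dualPairι_comp_hypOp`: `V(t,k,s) = sech t sech s · (1 + a(k)_{p₀p₀} b̄(k) tanh t tanh s)⁻¹`)
through the producer socket `vacuumOverlapPhase_neg_one_of_eq` and `χ_eq_mul_conj`.

## Main results

* `vacuumOverlapPhase_neg_one` — `VacuumOverlapPhase R S p₀ q₀ (-1)` for `[Unique R] [IsEmpty S] [Subsingleton Q]`;
* `isArchWeilDatum_linWeil_neg_one` — the linearised section `linWeil R S q₀ (-1)` IS an archimedean Weil datum of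
  `U(P,Q) × U(R,S)` (`|R| = 1`, `S = ∅`, `|Q| = 1`), unconditionally, with vacuum character `vacScalar ⟨0, -1, 0, 0⟩`.

BOUNDARY: no records, no `def … : Prop`, no cited hypothesis; `FockVacuumCharacter*` is not referenced.  The
`dim W_k = 2` slots (`|R| = 2`) need the instance `VacuumOverlapPhase R S p₀ q₀ (-2)`, NOT proved here.

## References

* [Folland1989] G. B. Folland, Harmonic analysis in phase space, 1989 — §1.7, §4.2 Prop. (4.39) (conventions).
* [KonnoKonno2007] T. Konno, K. Konno, 2007 — §3.1 (the dual pair; conventions).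
-/

set_option autoImplicit false

noncomputable section

namespace Literature.RepresentationTheory.KonnoKonno2007

namespace RealDualPair

open Literature.NumberTheory.Weil1964 Literature.Analysis.SegalBargmann
open Literature.NumberTheory.Automorphic Literature.NumberTheory.Automorphic.UnitaryGroup
open scoped ComplexConjugate

variable {P Q : Type*} (R S : Type*) [Fintype P] [DecidableEq P] [Fintype Q] [DecidableEq Q] [Fintype R]
  [DecidableEq R] [Fintype S] [DecidableEq S]

/-- **`(★★)_{-1}` holds on the `dim W_k = 1` slots**: for `|R| = 1`, `S = ∅`, `|Q| = 1` and every base point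
`(p₀, q₀)`, `VacuumOverlapPhase R S p₀ q₀ (-1)` — from the closed form
`V(t,k,s) = sech t sech s · (1 + a(k)_{p₀p₀} b̄(k) tanh t tanh s)⁻¹` (`vacCoeffS_hypOp_comp_dualPairι_comp_hypOp`).
[folklore] -/
theorem vacuumOverlapPhase_neg_one [Unique R] [IsEmpty S] [Subsingleton Q] (p₀ : P) (q₀ : Q) :
    VacuumOverlapPhase R S p₀ q₀ (-1) :=
  vacuumOverlapPhase_neg_one_of_eq R S p₀ q₀ fun t s k => by
    rw [vacOverlap, vacCoeffS_hypOp_comp_dualPairι_comp_hypOp, χ_eq_mul_conj, aP, bQ, starRingEnd_apply,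
      Complex.ofReal_mul (Real.tanh t)]
    simp only [mul_assoc]

/-- **The unconditional linearised Weil datum on the `dim W_k = 1` slots** (`U(P,Q) × U(1)`, `|Q| = 1`, `|R| = 1`,
`S = ∅`): `isArchWeilDatum_linWeil_of_isEmpty_right` with its hypothesis `hVV` DISCHARGED by
`vacuumOverlapPhase_neg_one` — a representation `ω = linWeil R S q₀ (-1)` of `G_∞` on `𝓢(ℝ^{DPIdx})` which is an
archimedean Weil datum over `ι𝕎`, with vacuum character `vacScalar ⟨0, -1, 0, 0⟩` on `K`. [folklore] -/
theorem isArchWeilDatum_linWeil_neg_one [Unique R] [IsEmpty S] [Subsingleton Q] (p₀ : P) (q₀ : Q) :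
    ∃ ω : Representation ℂ (Ginf P Q R S) (SchwartzMap (DPIdx P Q R S → ℝ) ℂ),
      IsArchWeilDatum (ι𝕎 P Q R S) ω ∧
      (∀ k : DPK P Q R S, ω (κ P Q R S k) (hermitePi 0) = vacScalar ⟨0, -1, 0, 0⟩ k • hermitePi 0) ∧
      ∀ g, ω g = linWeil R S q₀ (-1) g :=
  isArchWeilDatum_linWeil_of_isEmpty_right R S p₀ q₀ (vacuumOverlapPhase_neg_one R S p₀ q₀)

end RealDualPair

end Literature.RepresentationTheory.KonnoKonno2007
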